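import Literature.NumberTheory.Automorphic.GodementJacquetPartialL
import Literature.NumberTheory.Automorphic.GodementJacquetZetaIntegrals
import Literature.NumberTheory.Automorphic.GodementJacquetZetaIntegralsProofs
import HarnessLib

/-!
# lang.S21 (meromorphic continuation) from the Godement–Jacquet ingredients: the assembly

Topic `NumberTheory/Automorphic`; proof file (theorems only) on top of
`GodementJacquetPartialL` (first layer: `L^S ↦ L`, the complex-analytic glue, the named fact
`GodementJacquet1972_meromorphic_partialStandardL` = LNM 260 Thm. 13.8(2) for `L^S` on a right
half-plane, and the assembly `Lang.godementJacquet_hasMeromorphicContinuation_of_GJ_of_summable`)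
and `GodementJacquetZetaIntegrals` (second layer: the global zeta integrals `Z(Φ, s, φ, φ')`, the
named facts `GodementJacquet1972_gjZeta_meromorphic` (global theory, LNM 260 §12–§13) and
`GodementJacquet1972_gjZeta_eulerFactorisation` (Euler factorisation with Thm. 3.3, Lemma 6.10,
Thm. 8.7), and the proved zeta-quotient representation
`forall_exists_zeta_quotients_of_GodementJacquet1972`).

Composing the two gives the current frontier of the decomposition of the named fact
`Literature.NumberTheory.Automorphic.godementJacquet_hasMeromorphicContinuation` (`AutomorphicLFunctions`, **lang.S21**):
it holds as soon as (1) the global Godement–Jacquet zeta integrals of `K`-finite cuspidal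
coefficients continue meromorphically, (2) they factor as `A(s) · L^S(s, Π)` with `A` meromorphic
and not identically zero for suitable data, and (3) Jacquet–Shalika's (5.3.3)–(5.3.4)
(`summable_normSq_trace_satakePow`, holomorphy of `L^S` on `re s > 1`).

Ingredient (2) is now a theorem of the tree (`GodementJacquet1972_gjZeta_eulerFactorisation_holds`
of `GodementJacquetZetaIntegralsProofs`, the `K^T`-spherical unfolding), so the last section
records the sharper frontier: `GodementJacquet1972_meromorphic_partialStandardL` (LNM 260,
Thm. 13.8(2) for `L^S`) follows from the global theory `GodementJacquet1972_gjZeta_meromorphic`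
*alone* (`GodementJacquet1972_meromorphic_partialStandardL_of_gjZeta_meromorphic`), and the two
lang.S21 facts from it and `summable_normSq_trace_satakePow`.

## References

* R. Godement, H. Jacquet, *Zeta functions of simple algebras*, LNM 260 (1972), Thm. 13.8 with
  Thm. 3.3, Lemma 6.10, Thm. 8.7 [GodementJacquet1972].
* H. Jacquet, J. A. Shalika, *On Euler products and the classification of automorphic
  representations I*, Amer. J. Math. 103 (1981), Thm. (5.3) [JacquetShalikaAJM1981].
-/

noncomputable section

open NumberField IsDedekindDomain MeasureTheory

namespace Literature.NumberTheory.Automorphic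

variable {n : ℕ} {K : Type} [Field K] [NumberField K]
  {μ : Measure (AdelicGroupData.gl n K).automorphicQuotient}
  [(AdelicGroupData.gl n K).IsAutomorphicMeasure μ]

/-- **Godement–Jacquet, Thm. 13.8(2) for `L^S` (right-half-plane form) from the two printed
ingredients.** The named fact `GodementJacquet1972_meromorphic_partialStandardL` of
`GodementJacquetPartialL` — for every cuspidal `Π`, finite `S ⊇` ramified places and honest
Satake family `α` off `S`, some `g` meromorphic on `ℂ` agrees with `L^S(s, Π)` on a right
half-plane — follows from the global theory of the zeta integral
(`GodementJacquet1972_gjZeta_meromorphic`) and the Euler factorisation with local non-vanishing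
(`GodementJacquet1972_gjZeta_eulerFactorisation`), through
`forall_exists_zeta_quotients_of_GodementJacquet1972` and the complex-analytic glue
`GodementJacquet1972_meromorphic_partialStandardL_of_zeta_quotients` (`L^S = Z / A` off the
discrete zero set of `A`). [cite: GodementJacquet1972, Thm. 13.8] -/
theorem GodementJacquet1972_meromorphic_partialStandardL_of_gjZeta
    (h₁ : GodementJacquet1972_gjZeta_meromorphic (μ := μ))
    (h₂ : GodementJacquet1972_gjZeta_eulerFactorisation (μ := μ)) :
    GodementJacquet1972_meromorphic_partialStandardL (μ := μ) :=
  GodementJacquet1972_meromorphic_partialStandardL_of_zeta_quotients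
    (forall_exists_zeta_quotients_of_GodementJacquet1972 h₁ h₂)

end Literature.NumberTheory.Automorphic

namespace Literature.NumberTheory.Automorphic


variable {n : ℕ} {K : Type} [Field K] [NumberField K]
  {μ : Measure (AdelicGroupData.gl n K).automorphicQuotient}
  [(AdelicGroupData.gl n K).IsAutomorphicMeasure μ]

/-- **lang.S21 (partial L-functions) from the Godement–Jacquet ingredients and the single
Jacquet–Shalika input.** `partialStandardL_hasMeromorphicContinuation` (every honest
`L^S(s, Π)` is meromorphic on `ℂ`) follows from the global theory of the zeta integral
(`GodementJacquet1972_gjZeta_meromorphic`), its Euler factorisation with local non-vanishing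
(`GodementJacquet1972_gjZeta_eulerFactorisation`) — together: LNM 260, Thm. 13.8(2) for `L^S` on a
right half-plane — and `summable_normSq_trace_satakePow` (Jacquet–Shalika (1981), (5.3.3)–(5.3.4):
holomorphy of `L^S` on `re s > 1`), via
`partialStandardL_hasMeromorphicContinuation_of_GJ_of_summable`.
[cite: GodementJacquet1972, Thm. 13.8] [cite: JacquetShalikaAJM1981, Thm. (5.3)] -/
theorem partialStandardL_hasMeromorphicContinuation_of_gjZeta_of_summable
    (h₁ : GodementJacquet1972_gjZeta_meromorphic (μ := μ))
    (h₂ : GodementJacquet1972_gjZeta_eulerFactorisation (μ := μ))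
    (h₃ : summable_normSq_trace_satakePow (μ := μ)) :
    partialStandardL_hasMeromorphicContinuation (μ := μ) :=
  partialStandardL_hasMeromorphicContinuation_of_GJ_of_summable
    (GodementJacquet1972_meromorphic_partialStandardL_of_gjZeta h₁ h₂) h₃

/-- **lang.S21 (meromorphic continuation of `L(s, Π)` for every cuspidal `Π`) from the
Godement–Jacquet ingredients and the single Jacquet–Shalika input** — the current frontier of the
decomposition of `godementJacquet_hasMeromorphicContinuation`: it holds as soon as
(1) the global Godement–Jacquet zeta integrals of `K`-finite cuspidal coefficients continue
meromorphically (`GodementJacquet1972_gjZeta_meromorphic`, LNM 260 §12–§13), (2) they factor as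
`A(s) · L^S(s, Π)` with `A` meromorphic and not identically zero for suitable data
(`GodementJacquet1972_gjZeta_eulerFactorisation`, LNM 260 Thm. 13.8 with Thm. 3.3, Lemma 6.10,
Thm. 8.7), and (3) `∑_v |tr A_v^k|² q_v^{-kσ} < ∞` for `σ > 1` (`summable_normSq_trace_satakePow`,
Jacquet–Shalika (1981), (5.3.3)–(5.3.4), reduced in the tree to Lemma (5.2)). Assembly:
`godementJacquet_hasMeromorphicContinuation_of_GJ_of_summable` (Flath and the datum with junk-free
factors off `S`, `GodementJacquetPartialL`).
[cite: GodementJacquet1972, Thm. 13.8] [cite: JacquetShalikaAJM1981, Thm. (5.3)] -/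
theorem godementJacquet_hasMeromorphicContinuation_of_gjZeta_of_summable
    (h₁ : GodementJacquet1972_gjZeta_meromorphic (μ := μ))
    (h₂ : GodementJacquet1972_gjZeta_eulerFactorisation (μ := μ))
    (h₃ : summable_normSq_trace_satakePow (μ := μ)) :
    godementJacquet_hasMeromorphicContinuation (μ := μ) :=
  godementJacquet_hasMeromorphicContinuation_of_GJ_of_summable
    (GodementJacquet1972_meromorphic_partialStandardL_of_gjZeta h₁ h₂) h₃

end Literature.NumberTheory.Automorphic

/-! ### The frontier after the discharge of the Euler factorisation -/

namespace Literature.NumberTheory.Automorphic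

variable {n : ℕ} {K : Type} [Field K] [NumberField K]
  {μ : Measure (AdelicGroupData.gl n K).automorphicQuotient}
  [(AdelicGroupData.gl n K).IsAutomorphicMeasure μ]

/-- **Godement–Jacquet, Thm. 13.8(2) for `L^S` (right-half-plane form), from the global theory
of the zeta integral alone.** The named fact `GodementJacquet1972_meromorphic_partialStandardL`
of `GodementJacquetPartialL` follows from the single named input
`GodementJacquet1972_gjZeta_meromorphic` (LNM 260, §§11–13: the zeta integrals
`Z(Φ, s, φ, φ')` of Schwartz–Bruhat `Φ` against `K`-finite cuspidal coefficients converge in a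
right half-plane and continue meromorphically to `ℂ`), the second printed ingredient — the
Euler factorisation `Z(Φ, s + (n-1)/2, φ, φ') = A(s) · L^S(s, Π)` with `A` meromorphic and not
identically zero for suitable data (LNM 260, proof of Thm. 13.8 with Thm. 3.3, Lemma 6.10,
Thm. 8.7) — being the theorem `GodementJacquet1972_gjZeta_eulerFactorisation_holds` of
`GodementJacquetZetaIntegralsProofs`. This is the exact remaining debt of the fact: for the
data produced there (`φ' = φ` spherical off `T ⊇ S`, `Φ = Φ_∞ ⊗ 1_{B(𝔫)}`) the unfolding
identity exhibits `Z / L^T` as an entire function, non-zero far to the right, so the meromorphy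
of `Z` and that of `L^T` are equivalent and no weaker global input can serve.
[cite: GodementJacquet1972, Thm. 13.8 with Thm. 3.3] -/
theorem GodementJacquet1972_meromorphic_partialStandardL_of_gjZeta_meromorphic
    (h₁ : GodementJacquet1972_gjZeta_meromorphic (μ := μ)) :
    GodementJacquet1972_meromorphic_partialStandardL (μ := μ) :=
  GodementJacquet1972_meromorphic_partialStandardL_of_gjZeta h₁
    GodementJacquet1972_gjZeta_eulerFactorisation_holds

/-- **lang.S21 (partial L-functions) from the global Godement–Jacquet theory and the single
Jacquet–Shalika input.** `partialStandardL_hasMeromorphicContinuation` follows from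
`GodementJacquet1972_gjZeta_meromorphic` (LNM 260, §§11–13) and `summable_normSq_trace_satakePow`
(Jacquet–Shalika (1981), (5.3.3)–(5.3.4): holomorphy of `L^S` on `re s > 1`), the Euler
factorisation being proved (`GodementJacquet1972_gjZeta_eulerFactorisation_holds`).
[cite: GodementJacquet1972, Thm. 13.8] [cite: JacquetShalikaAJM1981, Thm. (5.3)] -/
theorem partialStandardL_hasMeromorphicContinuation_of_gjZeta_meromorphic_of_summable
    (h₁ : GodementJacquet1972_gjZeta_meromorphic (μ := μ))
    (h₃ : summable_normSq_trace_satakePow (μ := μ)) :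
    partialStandardL_hasMeromorphicContinuation (μ := μ) :=
  partialStandardL_hasMeromorphicContinuation_of_GJ_of_summable
    (GodementJacquet1972_meromorphic_partialStandardL_of_gjZeta_meromorphic h₁) h₃

/-- **lang.S21 (meromorphic continuation of `L(s, Π)` for every cuspidal `Π`) from the global
Godement–Jacquet theory and the single Jacquet–Shalika input** — the frontier of
`godementJacquet_hasMeromorphicContinuation` after the discharge of the Euler factorisation: it
holds as soon as (1) the global zeta integrals of `K`-finite cuspidal coefficients continue
meromorphically (`GodementJacquet1972_gjZeta_meromorphic`, LNM 260 §§11–13) and (3)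
`∑_v |tr A_v^k|² q_v^{-kσ} < ∞` for `σ > 1` (`summable_normSq_trace_satakePow`, Jacquet–Shalika
(1981), (5.3.3)–(5.3.4)). [cite: GodementJacquet1972, Thm. 13.8]
[cite: JacquetShalikaAJM1981, Thm. (5.3)] -/
theorem godementJacquet_hasMeromorphicContinuation_of_gjZeta_meromorphic_of_summable
    (h₁ : GodementJacquet1972_gjZeta_meromorphic (μ := μ))
    (h₃ : summable_normSq_trace_satakePow (μ := μ)) :
    godementJacquet_hasMeromorphicContinuation (μ := μ) :=
  godementJacquet_hasMeromorphicContinuation_of_GJ_of_summable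
    (GodementJacquet1972_meromorphic_partialStandardL_of_gjZeta_meromorphic h₁) h₃

end Literature.NumberTheory.Automorphic
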